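import Summits.ValiantsHypothesis.ValiantsHypothesis.Theorems.BarrierLeverPartitionMinorsHitByVPMaxPlus
import Summits.ValiantsHypothesis.ValiantsHypothesis.Theorems.BarrierLeverPartitionMinorsHitByVPProductStates
import Summits.ValiantsHypothesis.ValiantsHypothesis.Theorems.BarrierLeverTransversalResultantKernelNonsingularTropical
import Summits.ValiantsHypothesis.ValiantsHypothesis.Theses.BarrierLever

/-!
# Route BarrierLever — item `PartitionMinorsHitByVP` (stmt-ValiantsHypothesis-19717), part 3/3:
# SUMS OF PRODUCT STATES hit every partition minor that carries a max-plus assignment certificate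

Helper file (`--supports stmt-ValiantsHypothesis-19717`; cell valiant-natproofs, rung V4, 𝒟-side,
prover seat val-np-p3). Closes NO item.

**Setting.** Item 19717 asks, for `h ≥ h₀` and every layout `(u, w)` (`u_i, w_j ⊆ Fin h`, size `r`),
for some `f ∈ SmallCircuits ℂ (h+h) b` whose Nisan partition minor
`det (coeff_{x^{u_i} y^{w_j}} f)_{i,j}` is nonzero (`x_a = X (castAdd h a)`, `y_c = X (natAdd h c)`).
The tree reaches it through ONE universal witness family `det(1 + diag(x,y)·K)` and the chain
CT ⇒ TT ⇒ TNS ⇒ 19717 (items 19179/19180/19152/19153/19126/19133), whose open end is a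
unique-assignment statement for the Cauchy/resultant kernel
(`…ResultantKernel.det_resultantMatrix_ne_zero_of_unique_assignment`).

**This file: an ADAPTIVE witness family chosen per layout, directly inside `VP`, with its own
tropical certificate.** A product state with pairing `π : Fin h ≃ Fin h` and exponent tables
`φ a : Bool → Bool → ℕ` is `∏_a Σ_{e,e'} T^{φ a e e'} x_a^e y_{π a}^{e'}` (`T ∈ ℂ`); its partition
coefficient at `x^U y^W` is `T ^ (Σ_a φ a [a ∈ U] [π a ∈ W])` (part 2, `coeff_prodState`), and a SUM of
`m` product states has coefficient `Σ_k T^{score_k (U, W)}` (`coeff_sumProdStates`), degree `≤ 2h`,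
size `≤ 13·h·m + m` (`sumProdStates_mem_smallCircuits`: in `SmallCircuits ℂ (h+h) (c+2)` once
`m ≤ (2h)^c`, `h ≥ 4`). Part 1 (`det_sumPow_ne_zero_of_unique_max`, Mathlib only): a matrix with
entries `Σ_k X^{e k i j}` has nonzero determinant as soon as the MAX-PLUS assignment problem
`σ ↦ Σ_j max_k e k (σ j) j` has a unique maximiser.

**Theorem (`partitionMinor_hit_of_maxPlusCertificate`).** For `h ≥ 4`, a layout `(u, w)` and a
MAX-PLUS CERTIFICATE — `0 < m ≤ (h+h)^c` product states `(π k, φ k)` and a permutation `σ₀` that is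
the unique maximiser of `σ ↦ Σ_j max_k Σ_a φ k a [a ∈ u (σ j)] [π k a ∈ w j]` — there is
`f ∈ SmallCircuits ℂ (h+h) (c+2)` making the item's layout matrix (VERBATIM the matrix of item
19717) nonsingular; no injectivity of `u`, `w` is assumed (the certificate forces it).
One product state (`m = 1`): `b = 2` (`partitionMinor_hit_of_productStateCertificate`).
The arrow onto the route declaration: `partitionMinorsHitByVP_of_maxPlusCertificates` —
«every injective layout with `h ≥ h₀` has a certificate with `m ≤ (h+h)^c` product states» ⇒
`Theses.BarrierLever.PartitionMinorsHitByVP` (with `b = c + 2`).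

WHY A NEW RUNG: the certificate language is "max over `m` experts of a SUM of paired local scores";
for `m = 1` it is the bond-dimension-one (Kronecker) tropical test, incomparable with the
resultant-kernel certificates of the CT chain; the `max` lets a certificate DEDICATE product states
to sub-layouts (e.g. the cube-by-chain layouts `{U ⊆ A} × {[1, j]}`, `|A| = log₂ h`, which no single
Kronecker-type witness with `O(log h)`-size blocks hits, carry a certificate with `m = h`). The
combinatorial statement «every layout has a max-plus certificate with `m ≤ poly(h)`» would give item
19717 with NO determinant/Cauchy input; it is OPEN and finitely checkable per layout
(certificate = `(π_k, φ_k)_k, σ₀`).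

WHAT THIS IS NOT: not a proof of item 19717 (the certificate must be supplied); nothing on the
torus-balanced residue of items 20152/20239 beyond certified partition layouts; nothing on FSV
Question 6 / crux stmt-14610 or `VP` vs `VNP`.

References: [ForbesShpilkaVolk2018] §8 (rank methods / read-once determinants as distinguishers);
N. Nisan, STOC 1991 (partition matrix); Mulmuley–Vazirani–Vazirani 1987 and Klivans–Spielman 2001
(unique optimum ⇒ nonvanishing leading term); [Burgisser2000] §2.1 (size measure).
-/

set_option linter.dupNamespace false

namespace Summit.ValiantsHypothesis.ValiantsHypothesis.Theorems.BarrierLever.ProductStateSums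

open Finset MvPolynomial Literature.Barriers.ValiantsHypothesis

noncomputable section

/-- **Sums of product states hit certified partition minors.** Fix `c`. For `h ≥ 4`, a layout
`(u, w)` of size `r`, and a certificate — `0 < m ≤ (h+h)^c` product states (pairings `π k`,
exponent tables `φ k a : Bool → Bool → ℕ`) whose max-plus assignment problem
`σ ↦ Σ_j max_k Σ_a φ k a [a ∈ u (σ j)] [π k a ∈ w j]` has a UNIQUE maximiser `σ₀` — some
`f ∈ SmallCircuits ℂ (h+h) (c+2)` makes the layout matrix of item 19717 nonsingular. -/
theorem partitionMinor_hit_of_maxPlusCertificate (c h : ℕ) (hh : 4 ≤ h) (r : ℕ)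
    (u w : Fin r → Finset (Fin h)) (m : ℕ) (hm0 : 0 < m) (hm : m ≤ (h + h) ^ c)
    (π : Fin m → Equiv.Perm (Fin h)) (φ : Fin m → Fin h → Bool → Bool → ℕ)
    (σ₀ : Equiv.Perm (Fin r))
    (huniq : ∀ σ : Equiv.Perm (Fin r), σ ≠ σ₀ →
      ∑ j, univ.sup (fun k => ∑ a, φ k a (decide (a ∈ u (σ j))) (decide (π k a ∈ w j))) <
        ∑ j, univ.sup (fun k => ∑ a, φ k a (decide (a ∈ u (σ₀ j))) (decide (π k a ∈ w j)))) :
    ∃ f ∈ SmallCircuits ℂ (h + h) (c + 2),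
      (Matrix.of fun i j : Fin r => MvPolynomial.coeff
        (∑ a ∈ u i, Finsupp.single (Fin.castAdd h a) 1 +
          ∑ c ∈ w j, Finsupp.single (Fin.natAdd h c) 1) f).det ≠ 0 := by
  -- the one-parameter family of layout matrices `T ↦ (Σ_k T^{e k i j})`
  set e : Fin m → Fin r → Fin r → ℕ :=
    fun k i j => ∑ a, φ k a (decide (a ∈ u i)) (decide (π k a ∈ w j)) with he
  have hP : (Matrix.of fun i j : Fin r => ∑ k, (Polynomial.X : Polynomial ℂ) ^ e k i j).det ≠ 0 :=
    det_sumPow_ne_zero_of_unique_max hm0 e σ₀ huniq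
  obtain ⟨T, hT⟩ := ResultantKernel.exists_eval_ne_zero_of_ne_zero hP
  refine ⟨∑ k, ∏ a, ∑ p : Bool × Bool, C (T ^ φ k a p.1 p.2) * X (Fin.castAdd h a) ^ p.1.toNat *
      X (Fin.natAdd h (π k a)) ^ p.2.toNat, sumProdStates_mem_smallCircuits T hh hm π φ, ?_⟩
  have hmat : (Matrix.of fun i j : Fin r => MvPolynomial.coeff
        (∑ a ∈ u i, Finsupp.single (Fin.castAdd h a) 1 +
          ∑ c ∈ w j, Finsupp.single (Fin.natAdd h c) 1)
        (∑ k, ∏ a, ∑ p : Bool × Bool, C (T ^ φ k a p.1 p.2) * X (Fin.castAdd h a) ^ p.1.toNat *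
          X (Fin.natAdd h (π k a)) ^ p.2.toNat : MvPolynomial (Fin (h + h)) ℂ)) =
      (Polynomial.evalRingHom T).mapMatrix
        (Matrix.of fun i j : Fin r => ∑ k, (Polynomial.X : Polynomial ℂ) ^ e k i j) := by
    ext i j
    simp only [RingHom.mapMatrix_apply, Matrix.map_apply, Matrix.of_apply,
      Polynomial.coe_evalRingHom, Polynomial.eval_finsetSum, Polynomial.eval_pow,
      Polynomial.eval_X]
    exact coeff_sumProdStates T π φ (u i) (w j)
  rw [hmat, ← RingHom.map_det]
  exact hT

/-- **Single product state (`m = 1`, `b = 2`).** If ONE pairing `π` with tables `φ` has a unique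
maximiser `σ₀` of `σ ↦ Σ_j Σ_a φ a [a ∈ u (σ j)] [π a ∈ w j]`, the layout is hit by
`SmallCircuits ℂ (h+h) 2`. -/
theorem partitionMinor_hit_of_productStateCertificate (h : ℕ) (hh : 4 ≤ h) (r : ℕ)
    (u w : Fin r → Finset (Fin h)) (π : Equiv.Perm (Fin h)) (φ : Fin h → Bool → Bool → ℕ)
    (σ₀ : Equiv.Perm (Fin r))
    (huniq : ∀ σ : Equiv.Perm (Fin r), σ ≠ σ₀ →
      ∑ j, ∑ a, φ a (decide (a ∈ u (σ j))) (decide (π a ∈ w j)) <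
        ∑ j, ∑ a, φ a (decide (a ∈ u (σ₀ j))) (decide (π a ∈ w j))) :
    ∃ f ∈ SmallCircuits ℂ (h + h) 2,
      (Matrix.of fun i j : Fin r => MvPolynomial.coeff
        (∑ a ∈ u i, Finsupp.single (Fin.castAdd h a) 1 +
          ∑ c ∈ w j, Finsupp.single (Fin.natAdd h c) 1) f).det ≠ 0 := by
  have key := partitionMinor_hit_of_maxPlusCertificate 0 h hh r u w 1 Nat.one_pos (by simp)
    (fun _ => π) (fun _ => φ) σ₀
  simp only [Finset.univ_unique, Finset.sup_singleton] at key
  exact key huniq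

/-- **The arrow onto item 19717.** If, for some exponent `c` and threshold `h₀`, EVERY injective
layout with `h ≥ h₀` carries a max-plus certificate with at most `(h+h)^c` product states, then
`PartitionMinorsHitByVP` (stmt-ValiantsHypothesis-19717) holds, with `b = c + 2`. -/
theorem partitionMinorsHitByVP_of_maxPlusCertificates (c h₀ : ℕ)
    (hcert : ∀ h : ℕ, h₀ ≤ h → ∀ (r : ℕ) (u w : Fin r → Finset (Fin h)),
      Function.Injective u → Function.Injective w →
      ∃ (m : ℕ) (π : Fin m → Equiv.Perm (Fin h)) (φ : Fin m → Fin h → Bool → Bool → ℕ)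
        (σ₀ : Equiv.Perm (Fin r)), 0 < m ∧ m ≤ (h + h) ^ c ∧
        ∀ σ : Equiv.Perm (Fin r), σ ≠ σ₀ →
          ∑ j, univ.sup (fun k => ∑ a, φ k a (decide (a ∈ u (σ j))) (decide (π k a ∈ w j))) <
            ∑ j, univ.sup (fun k => ∑ a, φ k a (decide (a ∈ u (σ₀ j))) (decide (π k a ∈ w j)))) :
    Summit.ValiantsHypothesis.ValiantsHypothesis.Theses.BarrierLever.PartitionMinorsHitByVP := by
  refine ⟨c + 2, max h₀ 4, fun h hh r u w hu hw => ?_⟩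
  obtain ⟨m, π, φ, σ₀, hm0, hm, huniq⟩ := hcert h ((le_max_left _ _).trans hh) r u w hu hw
  exact partitionMinor_hit_of_maxPlusCertificate c h ((le_max_right _ _).trans hh) r u w m hm0 hm
    π φ σ₀ huniq

end

end Summit.ValiantsHypothesis.ValiantsHypothesis.Theorems.BarrierLever.ProductStateSums
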